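import Literature.MathematicalPhysics.QuantumManyBody.BoseGasWallCutoff
import Literature.MathematicalPhysics.QuantumManyBody.BoseGasDirichletMonotonicity
import HarnessLib

/-!
# Shrinking the Dirichlet box costs the near-wall energy (`stub_shrinkBound`)

Crux `stmt-AtomisticToContinuum-13034` (`RigidMomentumBound`, route `BECTangentRigidity`), line
`registered`, stub `stub_shrinkBound`: the elementary (variational) half of Hadamard's formula for
the Dirichlet ground-state energy of `N` bosons in the box `Λ_L`. For a measurable pair potential
`v`, a width `0 < w < L/2` and ANY admissible `u : TrialState N L`, with
`𝓔 = ∑_{j,a} ∫_{x_{j,a} > L-2w} (|∇u|² + ∑ v |u|²)` (the energy carried where some coordinate is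
within `2w` of its right wall, with multiplicity),
`E₀(N, L-w) · (1 - 4w² 𝓔) ≤ ⟨u, H u⟩ + 100 · 𝓔`.

Proof: multiply `u` by the product cut-off `χ(X) = ∏_{j,a} θ(x_{j,a})` with the explicit `C¹`
profile of `Literature/…/BoseGasWallCutoff.lean` (`WallCutoff.exists_wallProfile`: `θ = 1` left of
`L-2w`, `θ = 0` right of `L-w`, `|θ'| ≤ π/(2w)`); `χu` is `C¹`, Bose-symmetric and vanishes off
`Λ_{L-w}^N`, so `E₀(N, L-w) ∫|χu|² ≤ ∫ (|∇(χu)|² + ∑ v|χu|²)` (`groundStateEnergy_mul_normSq_le`).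
Pointwise `|∂_{j,a}(χu)|² ≤ |∂_{j,a}u|² + 1_{x_{j,a}>L-2w} |∂_{j,a}u|² + 2 (π/2w)² 1_{x_{j,a}>L-2w} |u|²`
(`WallCutoff.kineticDensity_cut_le`) and `∑v|χu|² ≤ ∑v|u|²`; Poincaré at the wall
(`lintegral_wall_le`) gives `∫_{x_{j,a}>L-2w}|u|² ≤ 4w² ∫_{x_{j,a}>L-2w}|∂_{j,a}u|²`, whence
`∫ (|∇(χu)|² + ∑v|χu|²) ≤ ⟨u,Hu⟩ + (1 + 2π²) 𝓔 ≤ ⟨u,Hu⟩ + 100 𝓔` and `1 ≤ ∫|χu|² + 4w² 𝓔`.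
Everything is a lower Lebesgue integral of nonnegative densities (no integration by parts).
-/

noncomputable section

namespace Summit.AtomisticToContinuum.BoseEinsteinCondensation.Theorems.RigidMomentumBound

open MeasureTheory Filter Set
open scoped ENNReal NNReal BigOperators Topology
open Literature.MathematicalPhysics.QuantumManyBody.BoseGas
open Literature.MathematicalPhysics.QuantumManyBody.BoseGas.WallCutoff

namespace ShrinkBound

/-- The numerical constant: `2 (π/2w)² · 4w² = 2π² ≤ 99`. [folklore] -/
theorem two_mul_slope_sq_mul_le {w : ℝ} (hw : 0 < w) :
    2 * ENNReal.ofReal ((Real.pi / (2 * w)) ^ 2) * ENNReal.ofReal (4 * w ^ 2) ≤ 99 := by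
  rw [← ENNReal.ofReal_ofNat 2, ← ENNReal.ofReal_mul (by norm_num),
    ← ENNReal.ofReal_mul (by positivity),
    show (2 : ℝ) * (Real.pi / (2 * w)) ^ 2 * (4 * w ^ 2) = 2 * Real.pi ^ 2 by
      field_simp; ring,
    ← ENNReal.ofReal_ofNat 99]
  refine ENNReal.ofReal_le_ofReal ?_
  nlinarith [Real.pi_le_four, Real.pi_pos]

end ShrinkBound

open ShrinkBound

/-- **`stub_shrinkBound` — shrinking the Dirichlet box costs the near-wall energy** (the
variational half of Hadamard's formula). For a measurable pair potential `v` (hard cores allowed),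
`N` particles, a box of side `L`, a width `0 < w < L/2` and ANY admissible `u` in the box `L`, with
`𝓔 = ∑_{j,a} ∫_{x_{j,a} > L-2w} (|∇u|² + ∑ v |u|²)`,
`E₀(N, L-w) · (1 - 4w² 𝓔) ≤ ⟨u, H u⟩ + 100 · 𝓔`.
Proof: the product cut-off `χ = ∏_{j,a} θ(x_{j,a})` with the `C¹` profile of `exists_wallProfile`
(`= 1` left of `L-2w`, `= 0` right of `L-w`, slope `≤ π/(2w)`); `χu` is admissible for the box
`L-w` (`groundStateEnergy_mul_normSq_le`), its energy exceeds `⟨u,Hu⟩` by at most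
`(1 + 2π²) 𝓔 ≤ 100 𝓔` (`kineticDensity_cut_le`, Poincaré at the wall `lintegral_wall_le`) and its
mass is at least `1 - 4w² 𝓔` (`ennnormSq_le_cut_add`, `lintegral_wall_le`). [folklore] -/
theorem stub_shrinkBound :
    ∀ (v : ℝ → ℝ≥0∞), Measurable v → ∀ {N : ℕ} {L w : ℝ}, 0 < w → 2 * w < L →
      ∀ u : TrialState N L,
        groundStateEnergy v N (L - w) *
            (1 - ENNReal.ofReal (4 * w ^ 2) *
              ∑ j : Fin N, ∑ a : Fin 3, ∫⁻ X in {X : Config N | L - 2 * w < X j a},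
                (kineticDensity u.ψ X + interaction v X * (‖u.ψ X‖₊ : ℝ≥0∞) ^ 2)) ≤
          energy v u +
            100 * ∑ j : Fin N, ∑ a : Fin 3, ∫⁻ X in {X : Config N | L - 2 * w < X j a},
              (kineticDensity u.ψ X + interaction v X * (‖u.ψ X‖₊ : ℝ≥0∞) ^ 2) := by
  intro v hv N L w hw hwL u
  set 𝓔 : ℝ≥0∞ := ∑ j : Fin N, ∑ a : Fin 3, ∫⁻ X in {X : Config N | L - 2 * w < X j a},
      (kineticDensity u.ψ X + interaction v X * (‖u.ψ X‖₊ : ℝ≥0∞) ^ 2) with h𝓔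
  -- the profile and the cut-off state
  obtain ⟨θ, hθc, hθ01, hθD, hθA, hθ1, hθ0⟩ := exists_wallProfile (L := L) hw
  set Φ : Config N → ℂ := fun X => u.ψ X * ((∏ p : Fin N × Fin 3, θ (X p.1 p.2) : ℝ) : ℂ)
    with hΦdef
  have hΦc : ContDiff ℝ 1 Φ :=
    u.contDiff.mul (Complex.ofRealCLM.contDiff.comp (contDiff_prod fun p _ => hθc.comp
      (((EuclideanSpace.proj p.2).comp (ContinuousLinearMap.proj (R := ℝ) p.1) :
        Config N →L[ℝ] ℝ).contDiff)))
  have hΦ0 : ∀ Y, Y ∉ boxN N (L - w) → Φ Y = 0 := by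
    intro Y hY
    by_contra hne
    apply hY
    intro i k
    have hψne : u.ψ Y ≠ 0 := fun h => hne (by simp only [hΦdef, h, zero_mul])
    have hQne : (∏ p : Fin N × Fin 3, θ (Y p.1 p.2)) ≠ 0 := fun h =>
      hne (by simp only [hΦdef, h, Complex.ofReal_zero, mul_zero])
    have hbox : Y ∈ boxN N L := not_not.1 fun h => hψne (u.eq_zero Y h)
    have hθne : θ (Y i k) ≠ 0 := Finset.prod_ne_zero_iff.1 hQne (i, k) (Finset.mem_univ _)
    exact ⟨(hbox i k).1, lt_of_not_ge fun hge => hθne (hθ0 _ hge)⟩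
  have hΦsymm : ∀ (σ : Equiv.Perm (Fin N)) (Y : Config N), Φ (Y ∘ σ) = Φ Y := by
    intro σ Y
    have hprod : (∏ p : Fin N × Fin 3, θ ((Y ∘ σ) p.1 p.2)) = ∏ p : Fin N × Fin 3, θ (Y p.1 p.2) :=
      Fintype.prod_equiv (σ.prodCongr (Equiv.refl (Fin 3))) _ _ fun p => by simp
    simp only [hΦdef, u.symm σ Y, hprod]
  -- densities, sets, measurability
  have hS : ∀ (i : Fin N) (k : Fin 3), MeasurableSet {X : Config N | L - 2 * w < X i k} :=
    fun i k => measurableSet_coordWall _ i k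
  set m : Config N → ℝ≥0∞ := fun X => (‖u.ψ X‖₊ : ℝ≥0∞) ^ 2 with hmdef
  set g : Fin N → Fin 3 → Config N → ℝ≥0∞ := fun i k X =>
    (‖fderiv ℝ u.ψ X (Pi.single i (EuclideanSpace.single k (1 : ℝ)))‖₊ : ℝ≥0∞) ^ 2 with hgdef
  have hm : Measurable m := measurable_ennnormSq u.contDiff.continuous
  have hg : ∀ i k, Measurable (g i k) := fun i k => measurable_ennnormSq_fderiv_apply u.contDiff _
  have hE_meas : Measurable fun X => kineticDensity u.ψ X + interaction v X * m X :=
    measurable_energyDensity hv u.contDiff.continuous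
  have hA_meas : Measurable fun X => ∑ i : Fin N, ∑ k : Fin 3,
      {X : Config N | L - 2 * w < X i k}.indicator (g i k) X :=
    Finset.measurable_sum _ fun i _ => Finset.measurable_sum _ fun k _ =>
      (hg i k).indicator (hS i k)
  have hB_meas : Measurable fun X => ∑ i : Fin N, ∑ k : Fin 3,
      {X : Config N | L - 2 * w < X i k}.indicator m X :=
    Finset.measurable_sum _ fun i _ => Finset.measurable_sum _ fun k _ => hm.indicator (hS i k)
  have hintA := lintegral_sum_sum_indicator hg hS
  have hintB := lintegral_sum_sum_indicator (fun (_ : Fin N) (_ : Fin 3) => hm) hS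
  -- (a) the `(i,k)`-derivative energy near the wall is part of `𝓔`
  have hgE : ∀ i k, ∫⁻ X in {X : Config N | L - 2 * w < X i k}, g i k X ≤
      ∫⁻ X in {X : Config N | L - 2 * w < X i k},
        (kineticDensity u.ψ X + interaction v X * (‖u.ψ X‖₊ : ℝ≥0∞) ^ 2) := by
    intro i k
    refine lintegral_mono fun X => ?_
    refine le_trans ?_ le_self_add
    unfold kineticDensity
    calc g i k X ≤ ∑ k' : Fin 3, g i k' X :=
          Finset.single_le_sum (f := fun k' => g i k' X) (fun _ _ => zero_le) (Finset.mem_univ k)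
      _ ≤ ∑ i' : Fin N, ∑ k' : Fin 3, g i' k' X :=
          Finset.single_le_sum (f := fun i' => ∑ k' : Fin 3, g i' k' X) (fun _ _ => zero_le)
            (Finset.mem_univ i)
  have hAE : ∑ i : Fin N, ∑ k : Fin 3, ∫⁻ X in {X : Config N | L - 2 * w < X i k}, g i k X ≤ 𝓔 :=
    Finset.sum_le_sum fun i _ => Finset.sum_le_sum fun k _ => hgE i k
  -- (b) Poincaré at the wall: the near-wall mass
  have hzero : ∀ (i : Fin N) (k : Fin 3) (X : Config N), L ≤ X i k → u.ψ X = 0 := by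
    intro i k X hX
    exact u.eq_zero X fun hbox => (not_lt.2 hX) (hbox i k).2
  have hmass : ∀ i k, ∫⁻ X in {X : Config N | L - 2 * w < X i k}, m X ≤
      ENNReal.ofReal (4 * w ^ 2) * ∫⁻ X in {X : Config N | L - 2 * w < X i k}, g i k X := by
    intro i k
    have h := lintegral_wall_le (L := L) (s := 2 * w) (by linarith) u.contDiff (hzero i k)
    rw [show (2 * w) ^ 2 = 4 * w ^ 2 by ring] at h
    exact h
  have hmassE : ∑ i : Fin N, ∑ k : Fin 3, ∫⁻ X in {X : Config N | L - 2 * w < X i k}, m X ≤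
      ENNReal.ofReal (4 * w ^ 2) * 𝓔 :=
    calc ∑ i : Fin N, ∑ k : Fin 3, ∫⁻ X in {X : Config N | L - 2 * w < X i k}, m X
        ≤ ∑ i : Fin N, ∑ k : Fin 3, ENNReal.ofReal (4 * w ^ 2) *
            ∫⁻ X in {X : Config N | L - 2 * w < X i k}, g i k X :=
          Finset.sum_le_sum fun i _ => Finset.sum_le_sum fun k _ => hmass i k
      _ = ENNReal.ofReal (4 * w ^ 2) *
            ∑ i : Fin N, ∑ k : Fin 3, ∫⁻ X in {X : Config N | L - 2 * w < X i k}, g i k X := by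
          simp only [Finset.mul_sum]
      _ ≤ ENNReal.ofReal (4 * w ^ 2) * 𝓔 := mul_le_mul_right hAE _
  -- (c) the energy of the cut-off state
  have hdens : ∀ X, kineticDensity Φ X + interaction v X * (‖Φ X‖₊ : ℝ≥0∞) ^ 2 ≤
      (kineticDensity u.ψ X + interaction v X * m X) +
        ((∑ i : Fin N, ∑ k : Fin 3, {X : Config N | L - 2 * w < X i k}.indicator (g i k) X) +
          2 * ENNReal.ofReal ((Real.pi / (2 * w)) ^ 2) *
            ∑ i : Fin N, ∑ k : Fin 3, {X : Config N | L - 2 * w < X i k}.indicator m X) := by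
    intro X
    have hk := kineticDensity_cut_le hθc hθ01 hθD hθA u.contDiff X
    have hp : interaction v X * (‖Φ X‖₊ : ℝ≥0∞) ^ 2 ≤ interaction v X * m X :=
      mul_le_mul_right (ennnormSq_cut_le hθ01 u.ψ X) _
    calc kineticDensity Φ X + interaction v X * (‖Φ X‖₊ : ℝ≥0∞) ^ 2
        ≤ (kineticDensity u.ψ X +
            (∑ i : Fin N, ∑ k : Fin 3, {X : Config N | L - 2 * w < X i k}.indicator (g i k) X) +
            2 * ENNReal.ofReal ((Real.pi / (2 * w)) ^ 2) *
              ∑ i : Fin N, ∑ k : Fin 3, {X : Config N | L - 2 * w < X i k}.indicator m X) +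
          interaction v X * m X := add_le_add hk hp
      _ = _ := by ring
  have henergy : ∫⁻ X, kineticDensity Φ X + interaction v X * (‖Φ X‖₊ : ℝ≥0∞) ^ 2 ≤
      energy v u + 100 * 𝓔 :=
    calc ∫⁻ X, kineticDensity Φ X + interaction v X * (‖Φ X‖₊ : ℝ≥0∞) ^ 2
        ≤ ∫⁻ X, ((kineticDensity u.ψ X + interaction v X * m X) +
            ((∑ i : Fin N, ∑ k : Fin 3, {X : Config N | L - 2 * w < X i k}.indicator (g i k) X) +
              2 * ENNReal.ofReal ((Real.pi / (2 * w)) ^ 2) *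
                ∑ i : Fin N, ∑ k : Fin 3, {X : Config N | L - 2 * w < X i k}.indicator m X)) :=
          lintegral_mono hdens
      _ = energy v u +
            ((∑ i : Fin N, ∑ k : Fin 3, ∫⁻ X in {X : Config N | L - 2 * w < X i k}, g i k X) +
              2 * ENNReal.ofReal ((Real.pi / (2 * w)) ^ 2) *
                ∑ i : Fin N, ∑ k : Fin 3, ∫⁻ X in {X : Config N | L - 2 * w < X i k}, m X) := by
          rw [lintegral_add_left hE_meas, lintegral_add_left hA_meas, lintegral_const_mul _ hB_meas,
            hintA, hintB]
          rfl
      _ ≤ energy v u + (𝓔 + 2 * ENNReal.ofReal ((Real.pi / (2 * w)) ^ 2) *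
            (ENNReal.ofReal (4 * w ^ 2) * 𝓔)) :=
          add_le_add_right (add_le_add hAE (mul_le_mul_right hmassE _)) _
      _ ≤ energy v u + 100 * 𝓔 := by
          refine add_le_add_right ?_ _
          calc 𝓔 + 2 * ENNReal.ofReal ((Real.pi / (2 * w)) ^ 2) * (ENNReal.ofReal (4 * w ^ 2) * 𝓔)
              = (1 + 2 * ENNReal.ofReal ((Real.pi / (2 * w)) ^ 2) * ENNReal.ofReal (4 * w ^ 2)) *
                  𝓔 := by ring
            _ ≤ (1 + 99) * 𝓔 := mul_le_mul_left (add_le_add_right (two_mul_slope_sq_mul_le hw) 1) 𝓔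
            _ = 100 * 𝓔 := by norm_num
  -- (d) the mass of the cut-off state
  have hnorm : 1 - ENNReal.ofReal (4 * w ^ 2) * 𝓔 ≤ ∫⁻ X, (‖Φ X‖₊ : ℝ≥0∞) ^ 2 := by
    refine tsub_le_iff_right.2 ?_
    calc (1 : ℝ≥0∞) = ∫⁻ X, m X := u.norm_eq.symm
      _ ≤ ∫⁻ X, ((‖Φ X‖₊ : ℝ≥0∞) ^ 2 +
            ∑ i : Fin N, ∑ k : Fin 3, {X : Config N | L - 2 * w < X i k}.indicator m X) :=
          lintegral_mono fun X => ennnormSq_le_cut_add hθ1 u.ψ X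
      _ = (∫⁻ X, (‖Φ X‖₊ : ℝ≥0∞) ^ 2) +
            ∑ i : Fin N, ∑ k : Fin 3, ∫⁻ X in {X : Config N | L - 2 * w < X i k}, m X := by
          rw [lintegral_add_right _ hB_meas, hintB]
      _ ≤ (∫⁻ X, (‖Φ X‖₊ : ℝ≥0∞) ^ 2) + ENNReal.ofReal (4 * w ^ 2) * 𝓔 :=
          add_le_add_right hmassE _
  -- (e) conclusion: the variational principle for the cut-off state in the box `L - w`
  calc groundStateEnergy v N (L - w) * (1 - ENNReal.ofReal (4 * w ^ 2) * 𝓔)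
      ≤ groundStateEnergy v N (L - w) * ∫⁻ X, (‖Φ X‖₊ : ℝ≥0∞) ^ 2 := mul_le_mul_right hnorm _
    _ ≤ ∫⁻ X, kineticDensity Φ X + interaction v X * (‖Φ X‖₊ : ℝ≥0∞) ^ 2 :=
        groundStateEnergy_mul_normSq_le v hΦc hΦ0 hΦsymm
    _ ≤ energy v u + 100 * 𝓔 := henergy
end Summit.AtomisticToContinuum.BoseEinsteinCondensation.Theorems.RigidMomentumBound

end
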